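import Literature.Analysis.OperatorTheory.SlabFibreContraction
import HarnessLib

/-!
# Slab operators of a time-sliced model: two ADJACENT / reflected blocks (gap `a + 1`) — PROVED

Topic `Literature/Analysis/OperatorTheory`; companion of `SlabFibreContraction.lean`.  Same setting: a cycle `ℤ/N` of
SLICE variables `xₜ ∈ X` (probability `μ`) with FIBRE variables `γₜ ∈ Γ` (probability `ν`), weight
`∏ₜ c(xₜ, γₜ, xₜ₊₁)` for a bounded measurable `0 ≤ c ≤ C_c`, and two bounded measurable BLOCK observables `α`, `β` of
`r + 2` consecutive slices and the `r + 1` fibres between them; `K(x,x') = ∫ c(x,γ,x') dν(γ)` is the fibre-averaged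
kernel and `X_α(u,u') = ∫∫ α(u ∷ v :: u', γ⃗) ∏ᵢ c(…) dν^{⊗(r+1)} dμ^{⊗r}` the contracted block kernel.

`slab_cyclic_two` of the companion file puts `α` at the sites `0, …, r+1` and `β` at `r+a+3, …, 2r+a+4` with
`N = 2r + a + b' + 6`, i.e. a gap of `a + 2 ≥ 2` bonds between the blocks.  Here is the SAME statement with the gap
ONE BOND SHORTER — the geometry of a reflected pair `ΘY · Y` of slab observables (Osterwalder–Seiler 1978, §2;
Seiler, LNP 159, Ch. 2), where for `a = 0` the two blocks are ADJACENT (they share no slice, exactly one free bond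
joins them):

* `slab_cyclic_two_succ` (**main**) — `α` at the sites `0, …, r+1`, `β` at the sites `r+a+2, …, 2r+a+3` of `ℤ/N`,
  `N = 2r + a + b' + 5`; the cyclic integral of `α(x_A, γ_A) β(x_B, γ_B) ∏ₜ c(xₜ, γₜ, xₜ₊₁)` over
  `μ^{⊗ℤ/N} ⊗ ν^{⊗ℤ/N}` equals the two-insertion heterogeneous cycle on `Fin (a + b' + 5)` with the bond kernels
  `X_α` (bond `0`), `X_β` (bond `a+2`) and `K` elsewhere — literally the left-hand side of
  `integral_cyclic_insert_two (a := a+1) (b' := b'+1)` (the path-space form of `Tr(𝕏_α 𝕂^{a+1} 𝕏_β 𝕂^{b'+2})`).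

The proof is the proof of `slab_cyclic_two` with the layout shifted by one (fibres along
`Fin (r+1) ⊕ (Fin (r+1) ⊕ C) ≃ ZMod N`, sites along `Fin (a+b'+5) ⊕ (Fin r ⊕ Fin r) ≃ ZMod N`, the outer site `s`
sitting at `0`, `r + s` (`1 ≤ s ≤ a+2`) or `2r + s` (`s ≥ a+3`)); all generic tools (`slab_zmod_equiv`,
`slab_integral_pi_window_two`, `slab_integral_pi_split`, `slab_integral_pi_two_blocks`, `slab_blockWeight_*`,
`slab_kernel_*`) are imported from the companion file.  `[folklore]` (Fubini–Tonelli on finite products of probability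
spaces); Mathlib + the companion file only; no definitions.
-/

noncomputable section

open MeasureTheory Filter

namespace Literature.Analysis.OperatorTheory

section Cyclic

variable {X Γ : Type*} [MeasurableSpace X] [MeasurableSpace Γ] {μ : Measure X} {ν : Measure Γ}
  [IsProbabilityMeasure μ] [IsProbabilityMeasure ν] {c : X → Γ → X → ℝ} {Cc : ℝ}

/-- **Two blocks inserted, gap `a + 1`: fibre integration, then contraction of both block interiors.**  Windows `A`
at the sites `0, …, r+1` and `B` at the sites `r+a+2, …, 2r+a+3` of the cycle `ℤ/N`, `N = 2r + a + b' + 5` (for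
`a = 0` the blocks are adjacent): the cyclic integral of `α(x_A, γ_A) β(x_B, γ_B) ∏ₜ c(xₜ, γₜ, xₜ₊₁)` equals the
heterogeneous cyclic integral on `Fin (a + b' + 5)` with the bond kernels `X_α` (bond `0`), `X_β` (bond `a+2`) and
`K` elsewhere (the two-insertion shape of `integral_cyclic_insert_two (a := a+1) (b' := b'+1)`).  The fibres are
integrated along the labelling `Fin (r+1) ⊕ (Fin (r+1) ⊕ C) ≃ ZMod N` and the sites along
`Fin (a+b'+5) ⊕ (Fin r ⊕ Fin r) ≃ ZMod N`, where `C = {s : Fin (a+b'+5) // s ≠ 0, a+2}` indexes the free bonds and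
the outer site `s` sits at `0`, `r + s` (`1 ≤ s ≤ a+2`) or `2r + s` (`s ≥ a+3`). [folklore] -/
theorem slab_cyclic_two_succ (hc : Measurable (fun q : X × Γ × X => c q.1 q.2.1 q.2.2))
    (hcb : ∀ x γ x', 0 ≤ c x γ x' ∧ c x γ x' ≤ Cc) {r : ℕ}
    {α β : (Fin (r + 2) → X) → (Fin (r + 1) → Γ) → ℝ} {Cα Cβ : ℝ}
    (hα : Measurable (fun q : (Fin (r + 2) → X) × (Fin (r + 1) → Γ) => α q.1 q.2))
    (hβ : Measurable (fun q : (Fin (r + 2) → X) × (Fin (r + 1) → Γ) => β q.1 q.2))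
    (hαb : ∀ W γs, |α W γs| ≤ Cα) (hβb : ∀ W γs, |β W γs| ≤ Cβ) {a b' N : ℕ} [NeZero N]
    (hN : N = 2 * r + a + b' + 4 + 1) :
    ∫ p : (ZMod N → X) × (ZMod N → Γ),
        α (fun i : Fin (r + 2) => p.1 ((i : ℕ) : ZMod N)) (fun i : Fin (r + 1) => p.2 ((i : ℕ) : ZMod N)) *
          β (fun i : Fin (r + 2) => p.1 ((r + a + 2 + (i : ℕ) : ℕ) : ZMod N))
            (fun i : Fin (r + 1) => p.2 ((r + a + 2 + (i : ℕ) : ℕ) : ZMod N)) *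
          ∏ t : ZMod N, c (p.1 t) (p.2 t) (p.1 (t + 1))
        ∂((Measure.pi fun _ => μ).prod (Measure.pi fun _ => ν)) =
      ∫ V : Fin (1 + (a + 1 + (b' + 1 + 1)) + 1) → X, ∏ t : Fin (1 + (a + 1 + (b' + 1 + 1)) + 1),
        (fun s : ℕ => if s = 0 then (fun u u' : X => ∫ v : Fin r → X, ∫ γs : Fin (r + 1) → Γ,
          α (Fin.cons u (Fin.snoc v u')) γs * ∏ i : Fin (r + 1),
            c ((Fin.cons u (Fin.snoc v u') : Fin (r + 2) → X) (Fin.castSucc i)) (γs i)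
              ((Fin.cons u (Fin.snoc v u') : Fin (r + 2) → X) (Fin.succ i)) ∂(Measure.pi fun _ => ν)
          ∂(Measure.pi fun _ => μ))
          else if s = a + 1 + 1 then (fun u u' : X => ∫ v : Fin r → X, ∫ γs : Fin (r + 1) → Γ,
          β (Fin.cons u (Fin.snoc v u')) γs * ∏ i : Fin (r + 1),
            c ((Fin.cons u (Fin.snoc v u') : Fin (r + 2) → X) (Fin.castSucc i)) (γs i)
              ((Fin.cons u (Fin.snoc v u') : Fin (r + 2) → X) (Fin.succ i)) ∂(Measure.pi fun _ => ν)
          ∂(Measure.pi fun _ => μ))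
          else fun x x' : X => ∫ γ, c (x) γ (x') ∂ν) (t : ℕ) (V t) (V (t + 1)) ∂(Measure.pi fun _ => μ) := by
  -- the outer cycle `Fin NN`, `NN = a + b' + 6`, the start `c3` of the contracted block `B`, the free bonds `C`
  obtain ⟨c3, hvc3⟩ : ∃ c3 : Fin (1 + (a + 1 + (b' + 1 + 1)) + 1), (c3 : ℕ) = a + 1 + 1 :=
    ⟨⟨a + 1 + 1, by omega⟩, rfl⟩
  have hvc4 : ((c3 + 1 : Fin (1 + (a + 1 + (b' + 1 + 1)) + 1)) : ℕ) = a + 1 + 1 + 1 := by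
    rw [Fin.val_add_one, if_neg, hvc3]
    intro h
    have := congrArg Fin.val h
    rw [hvc3, Fin.val_last] at this
    omega
  have hv1 : ((1 : Fin (1 + (a + 1 + (b' + 1 + 1)) + 1)) : ℕ) = 1 := by
    rw [Fin.val_one', Nat.mod_eq_of_lt (by omega)]
  have hmem : ∀ x : Fin (1 + (a + 1 + (b' + 1 + 1)) + 1),
      x ∈ ({0, c3} : Finset (Fin (1 + (a + 1 + (b' + 1 + 1)) + 1))) ↔ (x : ℕ) = 0 ∨ (x : ℕ) = a + 1 + 1 := by
    intro x
    rw [Finset.mem_insert, Finset.mem_singleton, Fin.ext_iff, Fin.ext_iff, Fin.val_zero, hvc3]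
  have h0c3 : (0 : Fin (1 + (a + 1 + (b' + 1 + 1)) + 1)) ≠ c3 := by
    intro h
    have := congrArg Fin.val h
    rw [Fin.val_zero, hvc3] at this
    omega
  have hcardC : Fintype.card {s : Fin (1 + (a + 1 + (b' + 1 + 1)) + 1) // ¬((s : ℕ) = 0 ∨ (s : ℕ) = a + 1 + 1)} =
      1 + (a + 1 + (b' + 1 + 1)) + 1 - 2 := by
    rw [Fintype.card_subtype_compl, Fintype.card_fin,
      Fintype.card_of_subtype ({0, c3} : Finset (Fin (1 + (a + 1 + (b' + 1 + 1)) + 1))) hmem,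
      Finset.card_pair h0c3]
  -- Step 1: Fubini, slices versus fibres
  have hPm : Measurable fun p : (ZMod N → X) × (ZMod N → Γ) =>
      ∏ t : ZMod N, c (p.1 t) (p.2 t) (p.1 (t + 1)) := by
    refine Finset.measurable_prod _ fun t _ => ?_
    have h1 : Measurable fun p : (ZMod N → X) × (ZMod N → Γ) => p.1 t :=
      (measurable_pi_apply t).comp measurable_fst
    have h2 : Measurable fun p : (ZMod N → X) × (ZMod N → Γ) => p.2 t :=
      (measurable_pi_apply t).comp measurable_snd
    have h3 : Measurable fun p : (ZMod N → X) × (ZMod N → Γ) => p.1 (t + 1) :=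
      (measurable_pi_apply (t + 1)).comp measurable_fst
    exact hc.comp (h1.prodMk (h2.prodMk h3))
  have hP0 : ∀ p : (ZMod N → X) × (ZMod N → Γ), 0 ≤ ∏ t : ZMod N, c (p.1 t) (p.2 t) (p.1 (t + 1)) :=
    fun p => Finset.prod_nonneg fun t _ => (hcb _ _ _).1
  have hPb : ∀ p : (ZMod N → X) × (ZMod N → Γ), ∏ t : ZMod N, c (p.1 t) (p.2 t) (p.1 (t + 1)) ≤ Cc ^ N :=
    fun p => calc
      _ ≤ ∏ _t : ZMod N, Cc := Finset.prod_le_prod (fun t _ => (hcb _ _ _).1) fun t _ => (hcb _ _ _).2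
      _ = Cc ^ N := by simp [ZMod.card]
  have hWm : Measurable fun p : (ZMod N → X) × (ZMod N → Γ) =>
      α (fun i : Fin (r + 2) => p.1 ((i : ℕ) : ZMod N)) (fun i : Fin (r + 1) => p.2 ((i : ℕ) : ZMod N)) *
        β (fun i : Fin (r + 2) => p.1 ((r + a + 2 + (i : ℕ) : ℕ) : ZMod N))
          (fun i : Fin (r + 1) => p.2 ((r + a + 2 + (i : ℕ) : ℕ) : ZMod N)) := by
    have h1 : Measurable fun p : (ZMod N → X) × (ZMod N → Γ) => fun i : Fin (r + 2) => p.1 ((i : ℕ) : ZMod N) :=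
      measurable_pi_lambda _ fun i => (measurable_pi_apply _).comp measurable_fst
    have h2 : Measurable fun p : (ZMod N → X) × (ZMod N → Γ) => fun i : Fin (r + 1) => p.2 ((i : ℕ) : ZMod N) :=
      measurable_pi_lambda _ fun i => (measurable_pi_apply _).comp measurable_snd
    have h3 : Measurable fun p : (ZMod N → X) × (ZMod N → Γ) =>
        fun i : Fin (r + 2) => p.1 ((r + a + 2 + (i : ℕ) : ℕ) : ZMod N) :=
      measurable_pi_lambda _ fun i => (measurable_pi_apply _).comp measurable_fst
    have h4 : Measurable fun p : (ZMod N → X) × (ZMod N → Γ) =>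
        fun i : Fin (r + 1) => p.2 ((r + a + 2 + (i : ℕ) : ℕ) : ZMod N) :=
      measurable_pi_lambda _ fun i => (measurable_pi_apply _).comp measurable_snd
    exact (hα.comp (h1.prodMk h2)).mul (hβ.comp (h3.prodMk h4))
  have hint : Integrable (fun p : (ZMod N → X) × (ZMod N → Γ) =>
      α (fun i : Fin (r + 2) => p.1 ((i : ℕ) : ZMod N)) (fun i : Fin (r + 1) => p.2 ((i : ℕ) : ZMod N)) *
        β (fun i : Fin (r + 2) => p.1 ((r + a + 2 + (i : ℕ) : ℕ) : ZMod N))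
          (fun i : Fin (r + 1) => p.2 ((r + a + 2 + (i : ℕ) : ℕ) : ZMod N)) *
        ∏ t : ZMod N, c (p.1 t) (p.2 t) (p.1 (t + 1))) ((Measure.pi fun _ => μ).prod (Measure.pi fun _ => ν)) := by
    refine Integrable.of_bound (hWm.mul hPm).aestronglyMeasurable (Cα * Cβ * Cc ^ N)
      (Eventually.of_forall fun p => ?_)
    rw [norm_mul, norm_mul, Real.norm_eq_abs, Real.norm_eq_abs, Real.norm_eq_abs, abs_of_nonneg (hP0 p)]
    have h0 : 0 ≤ Cα := (abs_nonneg _).trans (hαb (fun i : Fin (r + 2) => p.1 ((i : ℕ) : ZMod N))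
      (fun i : Fin (r + 1) => p.2 ((i : ℕ) : ZMod N)))
    have h0' : 0 ≤ Cβ := (abs_nonneg _).trans (hβb (fun i : Fin (r + 2) => p.1 ((r + a + 2 + (i : ℕ) : ℕ) : ZMod N))
      (fun i : Fin (r + 1) => p.2 ((r + a + 2 + (i : ℕ) : ℕ) : ZMod N)))
    exact mul_le_mul (mul_le_mul (hαb _ _) (hβb _ _) (abs_nonneg _) h0) (hPb p) (hP0 p) (mul_nonneg h0 h0')
  rw [integral_prod _ hint]
  dsimp only
  -- Step 2: fibre integration, pointwise in the slices
  obtain ⟨ef, hef⟩ := slab_zmod_equiv (N := N)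
    (Sum.elim (fun i : Fin (r + 1) => (i : ℕ))
      (Sum.elim (fun i : Fin (r + 1) => r + a + 2 + (i : ℕ))
        (fun s : {s : Fin (1 + (a + 1 + (b' + 1 + 1)) + 1) // ¬((s : ℕ) = 0 ∨ (s : ℕ) = a + 1 + 1)} =>
          if (s.1 : ℕ) = 0 then 0 else if (s.1 : ℕ) ≤ a + 2 then r + (s.1 : ℕ) else 2 * r + (s.1 : ℕ))))
    (by
      rintro (i | i | s)
      · simp only [Sum.elim_inl]; have := i.isLt; omega
      · simp only [Sum.elim_inr, Sum.elim_inl]; have := i.isLt; omega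
      · simp only [Sum.elim_inr]; have := s.1.isLt; split_ifs <;> omega)
    (by
      rintro (i | i | s) (i' | i' | s') h <;> simp only [Sum.elim_inl, Sum.elim_inr] at h
      · exact congrArg Sum.inl (Fin.ext h)
      · exfalso; have := i.isLt; omega
      · exfalso; have := i.isLt; have := s'.2; split_ifs at h <;> omega
      · exfalso; have := i'.isLt; omega
      · exact congrArg Sum.inr (congrArg Sum.inl (Fin.ext (by omega)))
      · exfalso; have := i.isLt; have := s'.2; have := s'.1.isLt; split_ifs at h <;> omega
      · exfalso; have := i'.isLt; have := s.2; split_ifs at h <;> omega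
      · exfalso; have := i'.isLt; have := s.2; have := s.1.isLt; split_ifs at h <;> omega
      · refine congrArg Sum.inr (congrArg Sum.inr (Subtype.ext (Fin.ext ?_)))
        have := s.2; have := s'.2; split_ifs at h <;> omega)
    (by simp only [Fintype.card_sum, Fintype.card_fin, hcardC]; omega)
  have hfib : ∀ x : ZMod N → X,
      ∫ γ : ZMod N → Γ, α (fun i : Fin (r + 2) => x ((i : ℕ) : ZMod N))
          (fun i : Fin (r + 1) => γ ((i : ℕ) : ZMod N)) *
          β (fun i : Fin (r + 2) => x ((r + a + 2 + (i : ℕ) : ℕ) : ZMod N))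
            (fun i : Fin (r + 1) => γ ((r + a + 2 + (i : ℕ) : ℕ) : ZMod N)) *
          ∏ t : ZMod N, c (x t) (γ t) (x (t + 1)) ∂(Measure.pi fun _ => ν) =
        (∫ γs : Fin (r + 1) → Γ, α (fun i : Fin (r + 2) => x ((i : ℕ) : ZMod N)) γs *
            ∏ i : Fin (r + 1), c ((fun i : Fin (r + 2) => x ((i : ℕ) : ZMod N)) (Fin.castSucc i)) (γs i)
              ((fun i : Fin (r + 2) => x ((i : ℕ) : ZMod N)) (Fin.succ i)) ∂(Measure.pi fun _ => ν)) *
          ((∫ γs : Fin (r + 1) → Γ, β (fun i : Fin (r + 2) => x ((r + a + 2 + (i : ℕ) : ℕ) : ZMod N)) γs *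
              ∏ i : Fin (r + 1), c ((fun i : Fin (r + 2) => x ((r + a + 2 + (i : ℕ) : ℕ) : ZMod N))
                (Fin.castSucc i)) (γs i) ((fun i : Fin (r + 2) => x ((r + a + 2 + (i : ℕ) : ℕ) : ZMod N))
                (Fin.succ i)) ∂(Measure.pi fun _ => ν)) *
            ∏ s : {s : Fin (1 + (a + 1 + (b' + 1 + 1)) + 1) // ¬((s : ℕ) = 0 ∨ (s : ℕ) = a + 1 + 1)},
              ∫ γ, c (x ((if (s.1 : ℕ) = 0 then 0 else if (s.1 : ℕ) ≤ a + 2 then r + (s.1 : ℕ)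
                else 2 * r + (s.1 : ℕ) : ℕ) : ZMod N)) γ
                (x (((if (s.1 : ℕ) = 0 then 0 else if (s.1 : ℕ) ≤ a + 2 then r + (s.1 : ℕ)
                  else 2 * r + (s.1 : ℕ) : ℕ) : ZMod N) + 1)) ∂ν) := by
    intro x
    have h := slab_integral_pi_window_two ν ef (fun t γ => c (x t) γ (x (t + 1)))
      (α fun i : Fin (r + 2) => x ((i : ℕ) : ZMod N))
      (β fun i : Fin (r + 2) => x ((r + a + 2 + (i : ℕ) : ℕ) : ZMod N))
    simp only [hef, Sum.elim_inl, Sum.elim_inr] at h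
    rw [h]
    congr 1
    · refine integral_congr_ae (Eventually.of_forall fun γs => ?_)
      dsimp only
      congr 1
      refine Fintype.prod_congr _ _ fun i => ?_
      simp only [Fin.val_castSucc, Fin.val_succ, Nat.cast_succ]
    · congr 1
      refine integral_congr_ae (Eventually.of_forall fun γs => ?_)
      dsimp only
      congr 1
      refine Fintype.prod_congr _ _ fun i => ?_
      have hi : ((r + a + 2 + (i : ℕ) : ℕ) : ZMod N) + 1 = ((r + a + 2 + ((i : ℕ) + 1) : ℕ) : ZMod N) := by
        push_cast; ring
      simp only [Fin.val_castSucc, Fin.val_succ, hi]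
  refine (integral_congr_ae (Eventually.of_forall fun x => hfib x)).trans ?_
  -- Step 3: contraction of the two block interiors
  obtain ⟨es, hes⟩ := slab_zmod_equiv (N := N)
    (Sum.elim (fun s : Fin (1 + (a + 1 + (b' + 1 + 1)) + 1) =>
        if (s : ℕ) = 0 then 0 else if (s : ℕ) ≤ a + 2 then r + (s : ℕ) else 2 * r + (s : ℕ))
      (Sum.elim (fun j : Fin r => (j : ℕ) + 1) (fun j : Fin r => r + a + 3 + (j : ℕ))))
    (by
      rintro (s | j | j)
      · simp only [Sum.elim_inl]; have := s.isLt; split_ifs <;> omega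
      · simp only [Sum.elim_inr, Sum.elim_inl]; have := j.isLt; omega
      · simp only [Sum.elim_inr]; have := j.isLt; omega)
    (by
      rintro (s | j | j) (s' | j' | j') h <;> simp only [Sum.elim_inl, Sum.elim_inr] at h
      · refine congrArg Sum.inl (Fin.ext ?_); split_ifs at h <;> omega
      · exfalso; have := j'.isLt; split_ifs at h <;> omega
      · exfalso; have := j'.isLt; have := s.isLt; split_ifs at h <;> omega
      · exfalso; have := j.isLt; split_ifs at h <;> omega
      · exact congrArg Sum.inr (congrArg Sum.inl (Fin.ext (by omega)))
      · exfalso; have := j.isLt; omega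
      · exfalso; have := j.isLt; have := s'.isLt; split_ifs at h <;> omega
      · exfalso; have := j'.isLt; omega
      · exact congrArg Sum.inr (congrArg Sum.inr (Fin.ext (by omega))))
    (by simp only [Fintype.card_sum, Fintype.card_fin]; omega)
  have hΨαm := slab_blockWeight_measurable (ν := ν) hc hα
  have hΨβm := slab_blockWeight_measurable (ν := ν) hc hβ
  have hKm := slab_kernel_measurable (ν := ν) hc
  have hGm : Measurable fun x : ZMod N → X =>
      (∫ γs : Fin (r + 1) → Γ, α (fun i : Fin (r + 2) => x ((i : ℕ) : ZMod N)) γs *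
          ∏ i : Fin (r + 1), c ((fun i : Fin (r + 2) => x ((i : ℕ) : ZMod N)) (Fin.castSucc i)) (γs i)
            ((fun i : Fin (r + 2) => x ((i : ℕ) : ZMod N)) (Fin.succ i)) ∂(Measure.pi fun _ => ν)) *
        ((∫ γs : Fin (r + 1) → Γ, β (fun i : Fin (r + 2) => x ((r + a + 2 + (i : ℕ) : ℕ) : ZMod N)) γs *
            ∏ i : Fin (r + 1), c ((fun i : Fin (r + 2) => x ((r + a + 2 + (i : ℕ) : ℕ) : ZMod N))
              (Fin.castSucc i)) (γs i) ((fun i : Fin (r + 2) => x ((r + a + 2 + (i : ℕ) : ℕ) : ZMod N))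
              (Fin.succ i)) ∂(Measure.pi fun _ => ν)) *
          ∏ s : {s : Fin (1 + (a + 1 + (b' + 1 + 1)) + 1) // ¬((s : ℕ) = 0 ∨ (s : ℕ) = a + 1 + 1)},
            ∫ γ, c (x ((if (s.1 : ℕ) = 0 then 0 else if (s.1 : ℕ) ≤ a + 2 then r + (s.1 : ℕ)
              else 2 * r + (s.1 : ℕ) : ℕ) : ZMod N)) γ
              (x (((if (s.1 : ℕ) = 0 then 0 else if (s.1 : ℕ) ≤ a + 2 then r + (s.1 : ℕ)
                else 2 * r + (s.1 : ℕ) : ℕ) : ZMod N) + 1)) ∂ν) := by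
    refine Measurable.mul ?_ (Measurable.mul ?_ (Finset.measurable_prod _ fun s _ => ?_))
    · exact hΨαm.comp (measurable_pi_lambda _ fun i : Fin (r + 2) => measurable_pi_apply (((i : ℕ) : ZMod N)))
    · exact hΨβm.comp (measurable_pi_lambda _ fun i : Fin (r + 2) =>
        measurable_pi_apply (((r + a + 2 + (i : ℕ) : ℕ) : ZMod N)))
    · have h1 : Measurable fun x : ZMod N → X => x ((if (s.1 : ℕ) = 0 then 0 else if (s.1 : ℕ) ≤ a + 2
          then r + (s.1 : ℕ) else 2 * r + (s.1 : ℕ) : ℕ) : ZMod N) := measurable_pi_apply _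
      have h2 : Measurable fun x : ZMod N → X => x (((if (s.1 : ℕ) = 0 then 0 else if (s.1 : ℕ) ≤ a + 2
          then r + (s.1 : ℕ) else 2 * r + (s.1 : ℕ) : ℕ) : ZMod N) + 1) := measurable_pi_apply _
      exact hKm.comp (h1.prodMk h2)
  have hGb : ∀ x : ZMod N → X,
      ‖(∫ γs : Fin (r + 1) → Γ, α (fun i : Fin (r + 2) => x ((i : ℕ) : ZMod N)) γs *
          ∏ i : Fin (r + 1), c ((fun i : Fin (r + 2) => x ((i : ℕ) : ZMod N)) (Fin.castSucc i)) (γs i)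
            ((fun i : Fin (r + 2) => x ((i : ℕ) : ZMod N)) (Fin.succ i)) ∂(Measure.pi fun _ => ν)) *
        ((∫ γs : Fin (r + 1) → Γ, β (fun i : Fin (r + 2) => x ((r + a + 2 + (i : ℕ) : ℕ) : ZMod N)) γs *
            ∏ i : Fin (r + 1), c ((fun i : Fin (r + 2) => x ((r + a + 2 + (i : ℕ) : ℕ) : ZMod N))
              (Fin.castSucc i)) (γs i) ((fun i : Fin (r + 2) => x ((r + a + 2 + (i : ℕ) : ℕ) : ZMod N))
              (Fin.succ i)) ∂(Measure.pi fun _ => ν)) *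
          ∏ s : {s : Fin (1 + (a + 1 + (b' + 1 + 1)) + 1) // ¬((s : ℕ) = 0 ∨ (s : ℕ) = a + 1 + 1)},
            ∫ γ, c (x ((if (s.1 : ℕ) = 0 then 0 else if (s.1 : ℕ) ≤ a + 2 then r + (s.1 : ℕ)
              else 2 * r + (s.1 : ℕ) : ℕ) : ZMod N)) γ
              (x (((if (s.1 : ℕ) = 0 then 0 else if (s.1 : ℕ) ≤ a + 2 then r + (s.1 : ℕ)
                else 2 * r + (s.1 : ℕ) : ℕ) : ZMod N) + 1)) ∂ν)‖ ≤
        Cα * Cc ^ (r + 1) * (Cβ * Cc ^ (r + 1) *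
          Cc ^ Fintype.card {s : Fin (1 + (a + 1 + (b' + 1 + 1)) + 1) // ¬((s : ℕ) = 0 ∨ (s : ℕ) = a + 1 + 1)}) :=
      fun x => by
    rw [norm_mul, norm_mul, Real.norm_eq_abs, Real.norm_eq_abs, Real.norm_eq_abs]
    have hA := slab_blockWeight_abs_le' (ν := ν) hc hcb hαb (fun i : Fin (r + 2) => x ((i : ℕ) : ZMod N))
    have hB := slab_blockWeight_abs_le' (ν := ν) hc hcb hβb
      (fun i : Fin (r + 2) => x ((r + a + 2 + (i : ℕ) : ℕ) : ZMod N))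
    have hR0 : 0 ≤ ∏ s : {s : Fin (1 + (a + 1 + (b' + 1 + 1)) + 1) // ¬((s : ℕ) = 0 ∨ (s : ℕ) = a + 1 + 1)},
        ∫ γ, c (x ((if (s.1 : ℕ) = 0 then 0 else if (s.1 : ℕ) ≤ a + 2 then r + (s.1 : ℕ)
          else 2 * r + (s.1 : ℕ) : ℕ) : ZMod N)) γ
          (x (((if (s.1 : ℕ) = 0 then 0 else if (s.1 : ℕ) ≤ a + 2 then r + (s.1 : ℕ)
            else 2 * r + (s.1 : ℕ) : ℕ) : ZMod N) + 1)) ∂ν :=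
      Finset.prod_nonneg fun s _ => (slab_kernel_bounds hcb _ _).1
    have hRb : ∏ s : {s : Fin (1 + (a + 1 + (b' + 1 + 1)) + 1) // ¬((s : ℕ) = 0 ∨ (s : ℕ) = a + 1 + 1)},
        ∫ γ, c (x ((if (s.1 : ℕ) = 0 then 0 else if (s.1 : ℕ) ≤ a + 2 then r + (s.1 : ℕ)
          else 2 * r + (s.1 : ℕ) : ℕ) : ZMod N)) γ
          (x (((if (s.1 : ℕ) = 0 then 0 else if (s.1 : ℕ) ≤ a + 2 then r + (s.1 : ℕ)
            else 2 * r + (s.1 : ℕ) : ℕ) : ZMod N) + 1)) ∂ν ≤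
        Cc ^ Fintype.card {s : Fin (1 + (a + 1 + (b' + 1 + 1)) + 1) // ¬((s : ℕ) = 0 ∨ (s : ℕ) = a + 1 + 1)} :=
      calc _ ≤ ∏ _s : {s : Fin (1 + (a + 1 + (b' + 1 + 1)) + 1) // ¬((s : ℕ) = 0 ∨ (s : ℕ) = a + 1 + 1)}, Cc :=
            Finset.prod_le_prod (fun s _ => (slab_kernel_bounds hcb _ _).1) fun s _ => (slab_kernel_bounds hcb _ _).2
        _ = _ := by simp
    rw [abs_of_nonneg hR0]
    have hB0 : 0 ≤ Cβ * Cc ^ (r + 1) := (abs_nonneg _).trans hB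
    exact mul_le_mul hA (mul_le_mul hB hRb hR0 hB0) (mul_nonneg (abs_nonneg _) hR0) ((abs_nonneg _).trans hA)
  refine (slab_integral_pi_split μ es hGm hGb).trans ?_
  refine integral_congr_ae (Eventually.of_forall fun W => ?_)
  -- Step 4: identification of the sites
  have hA' : ∀ (v : Fin r ⊕ Fin r → X) (i : Fin (r + 2)),
      Sum.elim W v (es.symm ((i : ℕ) : ZMod N)) =
        (Fin.cons (W 0) (Fin.snoc (fun j => v (Sum.inl j)) (W 1)) : Fin (r + 2) → X) i := by
    intro v i
    refine Fin.cases ?_ (fun j => ?_) i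
    · have h : es.symm (((0 : Fin (r + 2)) : ℕ) : ZMod N) = Sum.inl 0 := by
        rw [Equiv.symm_apply_eq, hes, Sum.elim_inl]; simp
      rw [h, Sum.elim_inl, Fin.cons_zero]
    · rw [Fin.cons_succ]
      refine Fin.lastCases ?_ (fun j' => ?_) j
      · have h : es.symm ((((Fin.last r).succ : Fin (r + 2)) : ℕ) : ZMod N) = Sum.inl 1 := by
          rw [Equiv.symm_apply_eq, hes, Sum.elim_inl, hv1, if_neg one_ne_zero, if_pos (by omega)]; simp
        rw [h, Sum.elim_inl, Fin.snoc_last]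
      · have h : es.symm (((j'.castSucc.succ : Fin (r + 2)) : ℕ) : ZMod N) = Sum.inr (Sum.inl j') := by
          rw [Equiv.symm_apply_eq, hes, Sum.elim_inr, Sum.elim_inl]; simp
        rw [h, Sum.elim_inr, Fin.snoc_castSucc]
  have hB' : ∀ (v : Fin r ⊕ Fin r → X) (i : Fin (r + 2)),
      Sum.elim W v (es.symm ((r + a + 2 + (i : ℕ) : ℕ) : ZMod N)) =
        (Fin.cons (W c3) (Fin.snoc (fun j => v (Sum.inr j)) (W (c3 + 1))) : Fin (r + 2) → X) i := by
    intro v i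
    refine Fin.cases ?_ (fun j => ?_) i
    · have h : es.symm (((r + a + 2 + ((0 : Fin (r + 2)) : ℕ) : ℕ)) : ZMod N) = Sum.inl c3 := by
        rw [Equiv.symm_apply_eq, hes, Sum.elim_inl, hvc3, if_neg (by omega), if_pos (by omega), Fin.val_zero]
        congr 1
      rw [h, Sum.elim_inl, Fin.cons_zero]
    · rw [Fin.cons_succ]
      refine Fin.lastCases ?_ (fun j' => ?_) j
      · have h : es.symm (((r + a + 2 + (((Fin.last r).succ : Fin (r + 2)) : ℕ) : ℕ)) : ZMod N) =
            Sum.inl (c3 + 1) := by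
          rw [Equiv.symm_apply_eq, hes, Sum.elim_inl, hvc4, if_neg (by omega), if_neg (by omega), Fin.val_succ,
            Fin.val_last]
          congr 1; omega
        rw [h, Sum.elim_inl, Fin.snoc_last]
      · have h : es.symm (((r + a + 2 + ((j'.castSucc.succ : Fin (r + 2)) : ℕ) : ℕ)) : ZMod N) =
            Sum.inr (Sum.inr j') := by
          rw [Equiv.symm_apply_eq, hes, Sum.elim_inr, Sum.elim_inr, Fin.val_succ, Fin.val_castSucc]
          congr 1; omega
        rw [h, Sum.elim_inr, Fin.snoc_castSucc]
  have hR1 : ∀ (v : Fin r ⊕ Fin r → X)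
      (s : {s : Fin (1 + (a + 1 + (b' + 1 + 1)) + 1) // ¬((s : ℕ) = 0 ∨ (s : ℕ) = a + 1 + 1)}),
      Sum.elim W v (es.symm ((if (s.1 : ℕ) = 0 then 0 else if (s.1 : ℕ) ≤ a + 2 then r + (s.1 : ℕ)
        else 2 * r + (s.1 : ℕ) : ℕ) : ZMod N)) = W s.1 := by
    intro v s
    have h : es.symm ((if (s.1 : ℕ) = 0 then 0 else if (s.1 : ℕ) ≤ a + 2 then r + (s.1 : ℕ)
        else 2 * r + (s.1 : ℕ) : ℕ) : ZMod N) = Sum.inl s.1 := by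
      rw [Equiv.symm_apply_eq, hes, Sum.elim_inl]
    rw [h, Sum.elim_inl]
  have hR2 : ∀ (v : Fin r ⊕ Fin r → X)
      (s : {s : Fin (1 + (a + 1 + (b' + 1 + 1)) + 1) // ¬((s : ℕ) = 0 ∨ (s : ℕ) = a + 1 + 1)}),
      Sum.elim W v (es.symm (((if (s.1 : ℕ) = 0 then 0 else if (s.1 : ℕ) ≤ a + 2 then r + (s.1 : ℕ)
        else 2 * r + (s.1 : ℕ) : ℕ) : ZMod N) + 1)) = W (s.1 + 1) := by
    intro v s
    have hs := s.2
    have h : es.symm (((if (s.1 : ℕ) = 0 then 0 else if (s.1 : ℕ) ≤ a + 2 then r + (s.1 : ℕ)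
        else 2 * r + (s.1 : ℕ) : ℕ) : ZMod N) + 1) = Sum.inl (s.1 + 1) := by
      rw [Equiv.symm_apply_eq, hes, Sum.elim_inl, Fin.val_add_one]
      by_cases hl : s.1 = Fin.last _
      · have hv : (s.1 : ℕ) = 1 + (a + 1 + (b' + 1 + 1)) := by
          have := congrArg Fin.val hl; rwa [Fin.val_last] at this
        rw [if_pos hl, if_pos rfl, if_neg (by omega), if_neg (by omega), ← Nat.cast_add_one,
          show 2 * r + (s.1 : ℕ) + 1 = N by omega, ZMod.natCast_self, Nat.cast_zero]
      · have hne : (s.1 : ℕ) ≠ 1 + (a + 1 + (b' + 1 + 1)) := fun h =>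
          hl (Fin.ext (h.trans (Fin.val_last _).symm))
        have hlt := s.1.isLt
        rw [if_neg hl, if_neg (Nat.add_one_ne_zero _)]
        split_ifs <;> first | (exfalso; omega) | (push_cast; ring)
    rw [h, Sum.elim_inl]
  have hsplit := slab_integral_pi_two_blocks μ (Equiv.refl (Fin r ⊕ Fin r))
    (fun v' : Fin r → X => ∫ γs : Fin (r + 1) → Γ, α (Fin.cons (W 0) (Fin.snoc v' (W 1))) γs *
      ∏ i : Fin (r + 1), c ((Fin.cons (W 0) (Fin.snoc v' (W 1)) : Fin (r + 2) → X) (Fin.castSucc i)) (γs i)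
        ((Fin.cons (W 0) (Fin.snoc v' (W 1)) : Fin (r + 2) → X) (Fin.succ i)) ∂(Measure.pi fun _ => ν))
    (fun v' : Fin r → X => ∫ γs : Fin (r + 1) → Γ, β (Fin.cons (W c3) (Fin.snoc v' (W (c3 + 1)))) γs *
      ∏ i : Fin (r + 1), c ((Fin.cons (W c3) (Fin.snoc v' (W (c3 + 1))) : Fin (r + 2) → X) (Fin.castSucc i))
        (γs i) ((Fin.cons (W c3) (Fin.snoc v' (W (c3 + 1))) : Fin (r + 2) → X) (Fin.succ i))
        ∂(Measure.pi fun _ => ν))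
  simp only [Equiv.refl_apply] at hsplit
  simp only [hA', hB', hR1, hR2, ← mul_assoc]
  rw [integral_mul_const, hsplit]
  -- Step 5: the heterogeneous bond product on the outer cycle
  rw [← Finset.prod_mul_prod_compl ({0, c3} : Finset (Fin (1 + (a + 1 + (b' + 1 + 1)) + 1))),
    Finset.prod_pair h0c3,
    Finset.prod_subtype (p := fun t : Fin (1 + (a + 1 + (b' + 1 + 1)) + 1) => ¬((t : ℕ) = 0 ∨ (t : ℕ) = a + 1 + 1))
      (F := inferInstance) _ (fun x => by rw [Finset.mem_compl, hmem])]
  simp only [Fin.val_zero, hvc3, zero_add, if_true, show ¬(a + 1 + 1 = 0) from by omega,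
    show ¬(0 = a + 1 + 1) from by omega, if_false]
  congr 1
  refine Fintype.prod_congr _ _ fun s => ?_
  rw [if_neg (fun h => s.2 (Or.inl h)), if_neg (fun h => s.2 (Or.inr h))]

end Cyclic

end Literature.Analysis.OperatorTheory

end
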